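import Summits.HodgeConjecture.HodgeConjecture.Theorems.K2E3KazhdanL2OrthonormalNotWild   -- FILE B (this seat): `pctOutLetters_of_pins`, `innerG_char_eq_ite_of_isL2_of_not_wild` (NOT-WILD [K] on L² pairs); brings FILE A ★ p855016
import Summits.HodgeConjecture.HodgeConjecture.Theorems.K2E1TraceFormulaBetaDefs            -- ★ (K2E1) reducible copies `Pl`∕`HLoc` of the organ leaf's local currency + the organ's vocabulary cone (as ★ `K2E3EllipticOfL2`)
import HarnessLib

/-!
# K2-LIT E3 · row #15 — file `K2E3KazhdanL2Orthonormal` (U5-c of the line `K2_E3_EllipticInputs`): [K] THEOREM K ∕ PROP. 12.6.1 (a) «THE SQUARE-INTEGRABLE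
# CHARACTERS ARE ORTHONORMAL FOR `⟨ , ⟩_e`» at the organ's pinned §12.5 datum — REDUCED BY NAME to Harish-Chandra's local boundedness + the WILD-place residual

Cell `pub/hodgecm-mathlib` (D-0151), Track B «K2-LIT» engine E3, seat `hodgecm-mathlib-K2E3-p15` (g0); crux H413 = `stmt-HodgeConjecture-24833` (lane `--supports …
--as helper`; count-neutral).  Socket: `Cruxes/H413/Lines/K2_E3_EllipticInputsSigs_U5Kazhdan.lean` (sha16 87d8b4c974a167d7) :47–147 `sig_K2E3KazhdanL2Orthonormal`,
conclusion `∀ π π′, 𝔇.IsL2 π → 𝔇.IsL2 π′ → 𝔇.innerG (𝔇.char π) (𝔇.char π′) = if π = π′ then 1 else 0` over the organ's 12 Cartan binders + datum + 54 pins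
(Printed: [Rogawski1990, Prop. 12.6.1 (a) p. 188] «If `π` is square-integrable, then `⟨χ_π, χ_π⟩_e = 1`»; orthogonality for `π ≠ π′` from [K] Thm. F∕K).
THEOREMS ONLY (no `def`, no instance, no notation, no named fact, no `sorry`; axioms ⊆ {propext, Classical.choice, Quot.sound}); never imports `Cruxes/…/Lines`.

WHAT IS PROVED.  `sig_K2E3KazhdanL2Orthonormal_of_charLocBdd_of_wild (hHCB) (hwild) : ‹sig_K2E3KazhdanL2Orthonormal›` — the SOCKET'S STATEMENT, pasted VERBATIM
(`Pl`∕`HLoc` are the reducible copies of ★ `K2E1TraceFormulaBetaDefs`, token-identical with the organ leaf's; tie by `type_of%`∕`rfl` probe at home), from exactly TWO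
named residuals:
* `hHCB : normalizedCharacter_locallyBounded` — Harish-Chandra's local boundedness of `|D_G|^{1∕2} χ_π` [HarishChandra1999 Thm. 16.3] = tier-0 stub 2 `stub_charLocBdd`
  of the SAME line (rows #12∕#14).  It is NOT among the socket's 54 pins, yet every ★ road to a value of `⟨χ_·, χ_·⟩_e` runs through ★ PCT-OUT, whose letter
  `L2CharOnTorusAll` the junction ★ J15 discharges ONLY from it — so the socket AS TYPED silently contains it (reported to the dealer for ED. 2: add the binder);
* `hwild` — THE WILD RESIDUAL: the socket's conclusion at a non-split place that is WILD (`¬ (v unramified in L ∨ |2|_v = 1)`: ramified AND dyadic), in the junction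
  letters of ★ 73 ∕ ★ (X0′-NW) (`hns`, the §12.5 datum pins `hμG horb hreg hE hM1`, the centre-quotient Haar `μZ` with `hμGZ`, and ★ PCT-OUT's `hWIF hC1 hC2 hC3 hL2`,
  all of which FILE B §0 supplies from the pins) — i.e. [K] Thm K at the wild places, where the tree has no Euler–Poincaré head yet (row #21 `sig_K2E3EPFunctionGWild`
  ∕ Track A «FOUR-FRAME»: once wild twins of ★ 73 and ★ (X0′-NW) exist, `hwild` is FILE B §1's proof verbatim with them).
At every NOT-WILD place the statement is a THEOREM: FILE B `innerG_char_eq_ite_of_isL2_of_not_wild` (NORM by ★ 73 + ★ (S5); CROSS by ★ (X0′-NW) + ★ HOM-ZERO +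
FILE A ★ p855016 `crossExtension_splits_of_isSquareIntegrable`).  PROOF: introduce the socket's binders; FILE B §0 turns the pins (+ `hHCB`) into ★ PCT-OUT's
letters; split on the place token; NOT-WILD ⇒ FILE B §1; WILD ⇒ `hwild`.
HONEST LABEL: row #15 is CLOSED MODULO {`normalizedCharacter_locallyBounded`, the WILD residual}; the socket itself stays OPEN (no `sig_` by name here); HC_CM is
proved only modulo the 7 printed citations (2 remaining named inputs hLiu418 = `stmt-HodgeConjecture-24832`, h413 = `stmt-HodgeConjecture-24833`) until rung 0 closes.

## References
* [Rogawski1990] J. D. Rogawski, *Automorphic Representations of Unitary Groups in Three Variables*, Ann. of Math. Stud. 123 (1990): §12.5 pp. 182–187; §12.6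
  p. 187 (`Tr π′(f_π) = ⟨χ_{π′}, χ_π⟩_e`), Prop. 12.6.1 (a)(b) p. 188, proof p. 189 («[H₄] Theorem 17», «Howe conjecture … proved by Clozel», «[K], Theorem F»).
* [Kazhdan1986CuspidalGeometry] D. Kazhdan, *Cuspidal geometry of p-adic groups*, J. Analyse Math. 47 (1986) 1–36: Thm. K (audit: WANT acq-15177).
* [HarishChandra1999] Harish-Chandra (eds. DeBacker–Sally), *Admissible invariant distributions on reductive p-adic groups*, AMS ULS 16 (1999): Thm. 16.3.
* [SchneiderStuhler1997] P. Schneider, U. Stuhler, Publ. Math. IHÉS 85 (1997): §III.4.  [Casselman1995] W. Casselman, draft (1995): §2.5, Thm. 4.4.6.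
-/

set_option autoImplicit false
-- the mandated namespace has the single-problem summit's repeated segment (`HodgeConjecture.HodgeConjecture`)
set_option linter.dupNamespace false

noncomputable section

open NumberField IsDedekindDomain MeasureTheory
open scoped Matrix MatrixGroups Valued NNReal
open Literature.NumberTheory.Rogawski1990 Literature.NumberTheory.Automorphic Literature.NumberTheory.Automorphic.UnitaryGroup
open Literature.NumberTheory.Automorphic.UnitaryGroup.CotangentForms Literature.NumberTheory.GaloisRepresentations
open Literature.NumberTheory.Automorphic.Arthur2013.Leaves.TECR
open Summit.HodgeConjecture.HodgeConjecture.Cruxes.H413.K2E1TraceFormulaBeta (Pl HLoc)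

namespace Summit.HodgeConjecture.HodgeConjecture.Cruxes.H413.K2E3KazhdanL2Orthonormal

open Summit.HodgeConjecture.HodgeConjecture.Cruxes.H413

/-! ## The socket BY ITS BYTES, from `hHCB` + the wild residual (statement VERBATIM from the sigs module :48–146) -/

set_option maxHeartbeats 1600000 in
set_option synthInstance.maxHeartbeats 400000 in
open Filter Topology Pointwise Summit.HodgeConjecture.HodgeConjecture.Cruxes.H413.F0P3cStCharTSTorusDefs in
open scoped Classical in
/-- **U5-c `sig_K2E3KazhdanL2Orthonormal` ⟸ `normalizedCharacter_locallyBounded` + THE WILD RESIDUAL** — [K] THEOREM K ∕ PROP. 12.6.1 (a): at the organ's PINNED §12.5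
datum `𝔇` (12 Cartan binders + 54 pins, text of `Cruxes/H413/Lines/K2_E3_EllipticInputsSigs_U5Kazhdan.lean` :48–146 pasted verbatim), `⟨χ_π, χ_{π′}⟩_e = δ_{π,π′}` for
all square-integrable `π`, `π′` of `U(Φ₃)(L⁺_v)`, `v` non-split.  The two hypotheses: `hHCB` = Harish-Chandra's local boundedness (tier-0 stub 2 of the same line; not a
pin of the socket, see the module docstring) and `hwild` = the same conclusion at the WILD places in the junction letters of ★ 73 ∕ ★ (X0′-NW) ([K] Thm K where no EP
head exists yet).  Proof: FILE B §0 `pctOutLetters_of_pins` (WIF, (C1)–(C3), (L2D∀) from the pins `hC01 hC04 hC05 hE hchar hAll hHaar hcart hHaarG hfinG hker eDG hcovA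
hncA hcptA hinvT hcoreT` + `hHCB`), then the place token: NOT-WILD ⇒ FILE B §1 `innerG_char_eq_ite_of_isL2_of_not_wild` (★ 73 + ★ (S5) ∕ ★ (X0′-NW) + ★ HOM-ZERO + FILE A);
WILD ⇒ `hwild`.  Printed: «(a) … If `π` is square-integrable, then `⟨χ_π, χ_π⟩_e = 1`» (p. 188); «Applying [K], Theorem F, we see that `⟨χ_π, χ_{π′}⟩ = 0` unless …» (p. 189).
[cite: Rogawski1990, Prop. 12.6.1 (a) p. 188, proof p. 189] [cite: Kazhdan1986CuspidalGeometry, Thm. K] [cite: HarishChandra1999, Thm. 16.3] [cite: SchneiderStuhler1997, §III.4] -/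
theorem sig_K2E3KazhdanL2Orthonormal_of_charLocBdd_of_wild
    (hHCB : normalizedCharacter_locallyBounded)
    (hwild : ∀ (L : Type) [Field L] [NumberField L] [IsCMField L] (v : Pl L),
      (∀ w : PlacesOver L v, IsCMField.complexConj L • w.1 = w.1) →
      ¬ (Algebra.IsUnramifiedIn (𝓞 L) v.asIdeal ∨ Valued.v (2 : v.adicCompletion ↥(maximalRealSubfield L)) = 1) →
      ∀ [MeasurableSpace (Gqs L v)] [BorelSpace (Gqs L v)]
        [∀ γ : Gqs L v, MeasurableSpace (Gqs L v ⧸ Subgroup.centralizer ({γ} : Set (Gqs L v)))]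
        [∀ γ : Gqs L v, BorelSpace (Gqs L v ⧸ Subgroup.centralizer ({γ} : Set (Gqs L v)))]
        [MeasurableSpace (Gqs L v ⧸ Subgroup.center (Gqs L v))] [BorelSpace (Gqs L v ⧸ Subgroup.center (Gqs L v))]
        {H : Type} [Group H] [TopologicalSpace H] [IsTopologicalGroup H] [MeasurableSpace H]
        (νQv : Measure (Gqs L v)) [νQv.IsHaarMeasure] [νQv.IsMulRightInvariant] (mQv : OrbitalMeasureFamily (Gqs L v)),
        mQv.IsCanonical (fun γ => IsRegularElt (γ.val : GL (Fin 3) (UnitaryGroup.LocalRing L v))) νQv →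
      ∀ (𝔇 : Ch12Sec5.EllipticData (Gqs L v) H), 𝔇.μG = νQv → 𝔇.orb = mQv →
        (∀ γ : Gqs L v, γ ∈ 𝔇.regG ↔ IsRegularElt (γ.val : GL (Fin 3) (UnitaryGroup.LocalRing L v))) →
        (∀ γ : Gqs L v, γ ∈ 𝔇.ellG ↔ IsRegularElt (γ.val : GL (Fin 3) (UnitaryGroup.LocalRing L v)) ∧ γ ∉ hyperbolicSet L v) →
        (∀ π : IrrClass (Gqs L v), Measurable (𝔇.char π) ∧ LocallyIntegrable (𝔇.char π) 𝔇.μG ∧ (∀ x ∈ 𝔇.regG, ∀ᶠ y in 𝓝 x, 𝔇.char π y = 𝔇.char π x) ∧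
          ∀ φ : Gqs L v → ℂ, IsLocSmooth φ → π.smoothTrace 𝔇.μG φ = ∫ x, φ x * 𝔇.char π x ∂𝔇.μG) →
      ∀ (μZ : Measure (Gqs L v ⧸ Subgroup.center (Gqs L v))) [μZ.IsHaarMeasure], 𝔇.μGZ = μZ →
        𝔇.WeylIntegrationFormula → 𝔇.EllCartanSubset → 𝔇.EllCartanAE → 𝔇.NonEllCartanAE → 𝔇.L2CharOnTorusAll →
      ∀ π π' : IrrClass (Gqs L v), 𝔇.IsL2 π → 𝔇.IsL2 π' → 𝔇.innerG (𝔇.char π) (𝔇.char π') = if π = π' then 1 else 0) :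
  ∀ (L : Type) [Field L] [NumberField L] [IsCMField L] (μ : HeckeCharacter L) (ξ : OneDimAutRepH L) (v : Pl L),
    (∀ w : PlacesOver L v, IsCMField.complexConj L • w.1 = w.1) → μ.IsUnitary →
    (∀ x : Literature.NumberTheory.GaloisRepresentations.ideleGroup ↥(maximalRealSubfield L),
      μ (AdeleRing.ideleBaseChange (↥(maximalRealSubfield L)) L x) = quadraticHeckeCharCM L x) →
    ∀ [MeasurableSpace (HLoc L v)] [BorelSpace (HLoc L v)] [MeasurableSpace (Gqs L v)] [BorelSpace (Gqs L v)]
      (νHv : Measure (HLoc L v)) (νQv : Measure (Gqs L v))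
      [νHv.IsHaarMeasure] [νHv.IsMulRightInvariant] [νQv.IsHaarMeasure] [νQv.IsMulRightInvariant],
    letI : ∀ a : HLoc L v, MeasurableSpace (HLoc L v ⧸ Subgroup.centralizer ({a} : Set (HLoc L v))) := fun _ => borel _
    haveI : ∀ a : HLoc L v, BorelSpace (HLoc L v ⧸ Subgroup.centralizer ({a} : Set (HLoc L v))) := fun _ => ⟨rfl⟩
    letI : ∀ γ : Gqs L v, MeasurableSpace (Gqs L v ⧸ Subgroup.centralizer ({γ} : Set (Gqs L v))) := fun _ => borel _
    haveI : ∀ γ : Gqs L v, BorelSpace (Gqs L v ⧸ Subgroup.centralizer ({γ} : Set (Gqs L v))) := fun _ => ⟨rfl⟩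
    ∀ (mHv : OrbitalMeasureFamily (HLoc L v)) (mQv : OrbitalMeasureFamily (Gqs L v)),
      mHv.IsCanonical (IsLocalGRegular L v) νHv →
      mQv.IsCanonical (fun γ => IsRegularElt (γ.val : GL (Fin 3) (UnitaryGroup.LocalRing L v))) νQv →
      IsLocalDeltaTransferExists L (qsForm L) v ((finExplicitCollection L (qsForm L) μ (finExplicitDelta_conj_left_all L (qsForm L) μ) (finExplicitDelta_conj_right_all L (qsForm L) μ)) v) mHv mQv IsLocSmooth IsLocSmooth →
      ∀ (π₁ πSt : IrrClass (HLoc L v)),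
        HLengthTwoLabels L v
          (torusCharPair (conjLocal L (IsCMField.complexConj L) v) (cmLocalForm L 2 v) (cmLocalForm_eq_over L 2 v) 0
            ((torusLocalComponent L (IsCMField.complexConj L) v ξ.η).comp
                (quotConj (conjLocal L (IsCMField.complexConj L) v) (conjLocal_conjLocal_cm L v)) *
              halfModulusChar (UnitaryGroup.LocalRing L v))
            (torusLocalComponent L (IsCMField.complexConj L) v ξ.ψ))
          ((torusLocalComponent L (IsCMField.complexConj L) v ξ.ψ).comp (localDet (IsCMField.complexConj L) v (isUnit_antidiagOne_det L 1))) π₁ πSt →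
        (∀ fH : HLoc L v → ℂ, IsLocSmooth fH → π₁.smoothTrace νHv fH = charDist (ξ.xiLocalChar v) νHv fH) →
      ∀ [MeasurableSpace (Gqs L v ⧸ Subgroup.center (Gqs L v))] [BorelSpace (Gqs L v ⧸ Subgroup.center (Gqs L v))]
        (μZ : Measure (Gqs L v ⧸ Subgroup.center (Gqs L v))) [μZ.IsHaarMeasure],
      ∀ (Sell : Finset (Subgroup (Gqs L v))) (μTf : (T' : Subgroup (Gqs L v)) → Measure ↥T') (SH : Finset (Subgroup ((UnitaryGroup.cmDatum L 2 (Matrix.of fun i j : Fin 2 => if i.val + j.val + 1 = 2 then (1 : L) else 0)).Local v × (UnitaryGroup.cmDatum L 1 (Matrix.of fun i j : Fin 1 => if i.val + j.val + 1 = 1 then (1 : L) else 0)).Local v))) (μTHf : (T' : Subgroup ((UnitaryGroup.cmDatum L 2 (Matrix.of fun i j : Fin 2 => if i.val + j.val + 1 = 2 then (1 : L) else 0)).Local v × (UnitaryGroup.cmDatum L 1 (Matrix.of fun i j : Fin 1 => if i.val + j.val + 1 = 1 then (1 : L) else 0)).Local v)) → Measure ↥T'),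
        (∀ T ∈ Sell, IsCompact (T : Set (Gqs L v)) ∧ ∃ γ₀ : Gqs L v, IsRegularElt (γ₀.val : GL (Fin 3) (UnitaryGroup.LocalRing L v)) ∧ T = Subgroup.centralizer ({γ₀} : Set (Gqs L v))) →  -- hcartO
        (∀ γ : (Gqs L v), IsRegularElt (γ.val : GL (Fin 3) (UnitaryGroup.LocalRing L v)) → ∃ T' ∈ insert (cmBorelTriple L 3 v).M Sell, ∃ x : (Gqs L v), ∀ g : (Gqs L v), g ∈ Subgroup.centralizer ({γ} : Set (Gqs L v)) ↔ x⁻¹ * g * x ∈ T') →  -- hcovGO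
        (∀ T' ∈ insert (cmBorelTriple L 3 v).M Sell, ∀ T'' ∈ insert (cmBorelTriple L 3 v).M Sell, T' ≠ T'' → ∀ y : (Gqs L v), ¬ ∀ h : (Gqs L v), h ∈ T'' ↔ y⁻¹ * h * y ∈ T') →  -- hncGO
        (∀ T ∈ Sell, (μTf T).IsHaarMeasure) →  -- hHaarGO
        (∀ T' ∈ Sell, μTf T' (compactCore ↥T') = 1) →  -- hcoreGO
        (μTf (cmBorelTriple L 3 v).M).IsHaarMeasure →  -- hHaarMO
        (μTf (cmBorelTriple L 3 v).M (compactCore ↥(cmBorelTriple L 3 v).M) = 1) →  -- hcoreMO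
        (∀ T' ∈ SH, IsCompact (T' : Set ((UnitaryGroup.cmDatum L 2 (Matrix.of fun i j : Fin 2 => if i.val + j.val + 1 = 2 then (1 : L) else 0)).Local v × (UnitaryGroup.cmDatum L 1 (Matrix.of fun i j : Fin 1 => if i.val + j.val + 1 = 1 then (1 : L) else 0)).Local v)) ∧ ∃ γ₀ : ((UnitaryGroup.cmDatum L 2 (Matrix.of fun i j : Fin 2 => if i.val + j.val + 1 = 2 then (1 : L) else 0)).Local v × (UnitaryGroup.cmDatum L 1 (Matrix.of fun i j : Fin 1 => if i.val + j.val + 1 = 1 then (1 : L) else 0)).Local v), IsLocalGRegular L v γ₀ ∧ T' = Subgroup.centralizer ({γ₀} : Set ((UnitaryGroup.cmDatum L 2 (Matrix.of fun i j : Fin 2 => if i.val + j.val + 1 = 2 then (1 : L) else 0)).Local v × (UnitaryGroup.cmDatum L 1 (Matrix.of fun i j : Fin 1 => if i.val + j.val + 1 = 1 then (1 : L) else 0)).Local v))) →  -- hKHO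
        (∀ γ₀ : ((UnitaryGroup.cmDatum L 2 (Matrix.of fun i j : Fin 2 => if i.val + j.val + 1 = 2 then (1 : L) else 0)).Local v × (UnitaryGroup.cmDatum L 1 (Matrix.of fun i j : Fin 1 => if i.val + j.val + 1 = 1 then (1 : L) else 0)).Local v), IsLocalGRegular L v γ₀ → IsCompact ((Subgroup.centralizer ({γ₀} : Set ((UnitaryGroup.cmDatum L 2 (Matrix.of fun i j : Fin 2 => if i.val + j.val + 1 = 2 then (1 : L) else 0)).Local v × (UnitaryGroup.cmDatum L 1 (Matrix.of fun i j : Fin 1 => if i.val + j.val + 1 = 1 then (1 : L) else 0)).Local v)) : Subgroup ((UnitaryGroup.cmDatum L 2 (Matrix.of fun i j : Fin 2 => if i.val + j.val + 1 = 2 then (1 : L) else 0)).Local v × (UnitaryGroup.cmDatum L 1 (Matrix.of fun i j : Fin 1 => if i.val + j.val + 1 = 1 then (1 : L) else 0)).Local v)) : Set ((UnitaryGroup.cmDatum L 2 (Matrix.of fun i j : Fin 2 => if i.val + j.val + 1 = 2 then (1 : L) else 0)).Local v × (UnitaryGroup.cmDatum L 1 (Matrix.of fun i j : Fin 1 =>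 if i.val + j.val + 1 = 1 then (1 : L) else 0)).Local v)) → ∃ T' ∈ SH, ∃ x : ((UnitaryGroup.cmDatum L 2 (Matrix.of fun i j : Fin 2 => if i.val + j.val + 1 = 2 then (1 : L) else 0)).Local v × (UnitaryGroup.cmDatum L 1 (Matrix.of fun i j : Fin 1 => if i.val + j.val + 1 = 1 then (1 : L) else 0)).Local v), Subgroup.centralizer ({x * γ₀ * x⁻¹} : Set ((UnitaryGroup.cmDatum L 2 (Matrix.of fun i j : Fin 2 => if i.val + j.val + 1 = 2 then (1 : L) else 0)).Local v × (UnitaryGroup.cmDatum L 1 (Matrix.of fun i j : Fin 1 => if i.val + j.val + 1 = 1 then (1 : L) else 0)).Local v)) = T') →  -- hcovHO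
        (∀ T' ∈ SH, ∀ T'' ∈ SH, (∃ x : ((UnitaryGroup.cmDatum L 2 (Matrix.of fun i j : Fin 2 => if i.val + j.val + 1 = 2 then (1 : L) else 0)).Local v × (UnitaryGroup.cmDatum L 1 (Matrix.of fun i j : Fin 1 => if i.val + j.val + 1 = 1 then (1 : L) else 0)).Local v), T'.map (MulAut.conj x).toMonoidHom = T'') → T' = T'') →  -- hncHO
        (∀ T' ∈ SH, (μTHf T').IsHaarMeasure) →  -- hHaarHO
        (∀ T' ∈ SH, IsProbabilityMeasure (μTHf T')) →  -- hprobHO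
        ∀ (𝔇 : Ch12Sec5.EllipticData (Gqs L v) ((UnitaryGroup.cmDatum L 2 (Matrix.of fun i j : Fin 2 => if i.val + j.val + 1 = 2 then (1 : L) else 0)).Local v × (UnitaryGroup.cmDatum L 1 (Matrix.of fun i j : Fin 1 => if i.val + j.val + 1 = 1 then (1 : L) else 0)).Local v)) (par : (IrrClass (Gqs L v) → ((((UnitaryGroup.LocalRing L v)ˣ →* ℂˣ) × (↥(normOneUnits (conjLocal L (IsCMField.complexConj L) v)) →* ℂˣ))))),
          𝔇.μG = νQv →  -- hC01
          𝔇.μH = νHv →  -- hC02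
          𝔇.μGZ = μZ →  -- hC03
          𝔇.orb = mQv →  -- hC04
          (∀ γ : Gqs L v, γ ∈ 𝔇.regG ↔ IsRegularElt (γ.val : GL (Fin 3) (UnitaryGroup.LocalRing L v))) →  -- hC05
          (∀ (φ : Gqs L v → ℂ) (fH : ((UnitaryGroup.cmDatum L 2 (Matrix.of fun i j : Fin 2 => if i.val + j.val + 1 = 2 then (1 : L) else 0)).Local v × (UnitaryGroup.cmDatum L 1 (Matrix.of fun i j : Fin 1 => if i.val + j.val + 1 = 1 then (1 : L) else 0)).Local v) → ℂ), 𝔇.IsTransfer φ fH ↔ IsLocalDeltaTransfer L (qsForm L) v ((finExplicitCollection L (qsForm L) μ (finExplicitDelta_conj_left_all L (qsForm L) μ) (finExplicitDelta_conj_right_all L (qsForm L) μ)) v) mHv mQv fH φ) →  -- hC06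
          ({πSt} : Finset (IrrClass (((UnitaryGroup.cmDatum L 2 (Matrix.of fun i j : Fin 2 => if i.val + j.val + 1 = 2 then (1 : L) else 0)).Local v × (UnitaryGroup.cmDatum L 1 (Matrix.of fun i j : Fin 1 => if i.val + j.val + 1 = 1 then (1 : L) else 0)).Local v)))) ∈ 𝔇.sqPacketsH →  -- hC07
          (∀ γ : Gqs L v, γ ∈ 𝔇.ellG ↔ IsRegularElt (γ.val : GL (Fin 3) (UnitaryGroup.LocalRing L v)) ∧ γ ∉ hyperbolicSet L v) →  -- hE
          (∀ π : IrrClass (Gqs L v), Measurable (𝔇.char π) ∧ LocallyIntegrable (𝔇.char π) 𝔇.μG ∧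
          (∀ x ∈ 𝔇.regG, ∀ᶠ y in 𝓝 x, 𝔇.char π y = 𝔇.char π x) ∧
          ∀ φ : Gqs L v → ℂ, IsLocSmooth φ → π.smoothTrace 𝔇.μG φ = ∫ x, φ x * 𝔇.char π x ∂𝔇.μG) →  -- hchar
          (∀ T : Subgroup (Gqs L v), T ∈ 𝔇.cartanAll ↔ T = (cmBorelTriple L 3 v).M ∨ T ∈ 𝔇.cartanG) →  -- hAll
          (𝔇.μT (cmBorelTriple L 3 v).M).IsHaarMeasure →  -- hHaar
          (∀ T ∈ 𝔇.cartanG, IsCompact (T : Set (Gqs L v)) ∧ ∃ γ₀ : Gqs L v, IsRegularElt (γ₀.val : GL (Fin 3) (UnitaryGroup.LocalRing L v)) ∧ T = Subgroup.centralizer ({γ₀} : Set (Gqs L v))) →  -- hcart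
          (∀ T ∈ 𝔇.cartanG, (𝔇.μT T).IsHaarMeasure) →  -- hHaarG
          (∀ T ∈ 𝔇.cartanG, IsFiniteMeasure (𝔇.μT T)) →  -- hfinG
          (∀ T ∈ 𝔇.cartanG, ∃ s : Finset (Subgroup ↥T), (∀ K ∈ s, IsClosed (K : Set ↥T) ∧ ¬ IsOpen (K : Set ↥T)) ∧ ∀ t : ↥T, ¬ IsRegularElt ((t : Gqs L v).val : GL (Fin 3) (UnitaryGroup.LocalRing L v)) → ∃ K ∈ s, t ∈ K) →  -- hker
          (∀ g : Gqs L v, 𝔇.DG g = ((NNReal.sqrt (NNReal.sqrt ((∏ w : PlacesOver L v, IsNonarchimedeanLocalField.normAbs (w.1.adicCompletion L) (((g.val : GL (Fin 3) (UnitaryGroup.LocalRing L v)).val.charpoly.discr) w)) * ((∏ w : PlacesOver L v, IsNonarchimedeanLocalField.normAbs (w.1.adicCompletion L) (((g.val : GL (Fin 3) (UnitaryGroup.LocalRing L v)).val.det) w)) ^ 2)⁻¹)) : NNReal) : ℝ)) →  -- eDG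
          (∀ s : ((UnitaryGroup.cmDatum L 2 (Matrix.of fun i j : Fin 2 => if i.val + j.val + 1 = 2 then (1 : L) else 0)).Local v × (UnitaryGroup.cmDatum L 1 (Matrix.of fun i j : Fin 1 => if i.val + j.val + 1 = 1 then (1 : L) else 0)).Local v), 𝔇.DH s = ((NNReal.sqrt (NNReal.sqrt ((∏ w : PlacesOver L v, IsNonarchimedeanLocalField.normAbs (w.1.adicCompletion L) (((s.1.val : GL (Fin 2) (UnitaryGroup.LocalRing L v)).val.charpoly.discr) w)) * (∏ w : PlacesOver L v, IsNonarchimedeanLocalField.normAbs (w.1.adicCompletion L) (((s.1.val : GL (Fin 2) (UnitaryGroup.LocalRing L v)).val.det) w))⁻¹)) : NNReal) : ℝ)) →  -- eDH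
          (∀ T ∈ 𝔇.cartanH, IsCompact (T : Set ((UnitaryGroup.cmDatum L 2 (Matrix.of fun i j : Fin 2 => if i.val + j.val + 1 = 2 then (1 : L) else 0)).Local v × (UnitaryGroup.cmDatum L 1 (Matrix.of fun i j : Fin 1 => if i.val + j.val + 1 = 1 then (1 : L) else 0)).Local v))) →  -- hKH
          (∀ T ∈ 𝔇.cartanH, IsFiniteMeasure (𝔇.μTH T)) →  -- hFH
          (∀ ρ ∈ 𝔇.sqPacketsH, ∀ T ∈ 𝔇.cartanH, ∀ C : Set ((UnitaryGroup.cmDatum L 2 (Matrix.of fun i j : Fin 2 => if i.val + j.val + 1 = 2 then (1 : L) else 0)).Local v × (UnitaryGroup.cmDatum L 1 (Matrix.of fun i j : Fin 1 => if i.val + j.val + 1 = 1 then (1 : L) else 0)).Local v), IsCompact C → C ⊆ (T : Set ((UnitaryGroup.cmDatum L 2 (Matrix.of fun i j : Fin 2 => if i.val + j.val + 1 = 2 then (1 : L) else 0)).Local v × (UnitaryGroup.cmDatum L 1 (Matrix.of fun i j : Fin 1 => if i.val + j.val + 1 = 1 then (1 : L) else 0)).Local v)) → ∃ B : ℝ,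 ∀ γ ∈ C, ‖(𝔇.DH γ : ℂ) * 𝔇.packetCharH ρ γ‖ ≤ B) →  -- hHBH
          (∀ π : IrrClass (Gqs L v), ¬ π.IsSquareIntegrable μZ → π.IsConstituentOf (UnitaryGroup.cmPrincipalSeries L 3 v (UnitaryGroup.cmTorusCharPair L v (par π).1 (par π).2)) ∧ Continuous (par π).1 ∧ Continuous (par π).2) →  -- hNL
          (∀ π : IrrClass (Gqs L v), (∃ (χ₁ : (UnitaryGroup.LocalRing L v)ˣ →* ℂˣ) (χ₂ : ↥(normOneUnits (conjLocal L (IsCMField.complexConj L) v)) →* ℂˣ), Continuous (fun x => ((χ₁ x : ℂˣ) : ℂ)) ∧ Continuous (fun x => ((χ₂ x : ℂˣ) : ℂ)) ∧ (UnitaryGroup.cmPrincipalSeries L 3 v (UnitaryGroup.cmTorusCharPair L v χ₁ χ₂)).IsIrreducible ∧ π.IsConstituentOf (UnitaryGroup.cmPrincipalSeries L 3 v (UnitaryGroup.cmTorusCharPair L v χ₁ χ₂))) → (UnitaryGroup.cmPrincipalSeries L 3 v (UnitaryGroup.cmTorusCharPair L v (par π).1 (par π).2)).IsIrreducible ∧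 π.IsConstituentOf (UnitaryGroup.cmPrincipalSeries L 3 v (UnitaryGroup.cmTorusCharPair L v (par π).1 (par π).2)) ∧ Continuous (par π).1 ∧ Continuous (par π).2 ∧ Continuous (fun x => (((par π).1 x : ℂˣ) : ℂ)) ∧ Continuous (fun x => (((par π).2 x : ℂˣ) : ℂ)) ∧ ∀ (ν : Measure (Gqs L v)) (f : Gqs L v → ℂ), π.smoothTrace ν f = Representation.smoothTrace (G := Gqs L v) (UnitaryGroup.cmPrincipalSeries L 3 v (UnitaryGroup.cmTorusCharPair L v (par π).1 (par π).2)) ν f) →  -- hPSpar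
          (∀ P : Finset (IrrClass (Gqs L v)), P ∈ 𝔇.ldsPackets ↔ (P.card = 2 ∧ ∃ (χ₁ : (UnitaryGroup.LocalRing L v)ˣ →* ℂˣ) (χ₂ : ↥(normOneUnits (conjLocal L (IsCMField.complexConj L) v)) →* ℂˣ), Continuous (fun x => ((χ₁ x : ℂˣ) : ℂ)) ∧ Continuous (fun x => ((χ₂ x : ℂˣ) : ℂ)) ∧ (∀ a : (UnitaryGroup.LocalRing L v)ˣ, (conjLocal L (IsCMField.complexConj L) v) (a : UnitaryGroup.LocalRing L v) = a → χ₁ a = 1) ∧ χ₁ ≠ 1 ∧ ∀ c : IrrClass (Gqs L v), c ∈ P ↔ c.IsConstituentOf (UnitaryGroup.cmPrincipalSeries L 3 v (UnitaryGroup.cmTorusCharPair L v χ₁ χ₂)))) →  -- hLdsF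
          (∀ (χ₁ : (UnitaryGroup.LocalRing L v)ˣ →* ℂˣ) (χ₂ : ↥(normOneUnits (conjLocal L (IsCMField.complexConj L) v)) →* ℂˣ), Continuous (fun x => ((χ₁ x : ℂˣ) : ℂ)) → Continuous (fun x => ((χ₂ x : ℂˣ) : ℂ)) → ∀ π π' : IrrClass (Gqs L v), ¬ π.IsSquareIntegrable μZ → ¬ π'.IsSquareIntegrable μZ → π.IsConstituentOf (UnitaryGroup.cmPrincipalSeries L 3 v (UnitaryGroup.cmTorusCharPair L v χ₁ χ₂)) → π'.IsConstituentOf (UnitaryGroup.cmPrincipalSeries L 3 v (UnitaryGroup.cmTorusCharPair L v χ₁ χ₂)) → par π = par π') →  -- hW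
          (∀ a b : ((UnitaryGroup.cmDatum L 2 (Matrix.of fun i j : Fin 2 => if i.val + j.val + 1 = 2 then (1 : L) else 0)).Local v × (UnitaryGroup.cmDatum L 1 (Matrix.of fun i j : Fin 1 => if i.val + j.val + 1 = 1 then (1 : L) else 0)).Local v), 𝔇.stConjH a b ↔ IsLocalStablyConjH L v a b) →  -- hStH
          (∀ a : ((UnitaryGroup.cmDatum L 2 (Matrix.of fun i j : Fin 2 => if i.val + j.val + 1 = 2 then (1 : L) else 0)).Local v × (UnitaryGroup.cmDatum L 1 (Matrix.of fun i j : Fin 1 => if i.val + j.val + 1 = 1 then (1 : L) else 0)).Local v), IsLocalGRegular L v a → a ∈ 𝔇.regH) →  -- hRegH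
          (∀ (α : ((UnitaryGroup.cmDatum L 2 (Matrix.of fun i j : Fin 2 => if i.val + j.val + 1 = 2 then (1 : L) else 0)).Local v × (UnitaryGroup.cmDatum L 1 (Matrix.of fun i j : Fin 1 => if i.val + j.val + 1 = 1 then (1 : L) else 0)).Local v) → ℂ) (x : Gqs L v), 𝔇.up α x = if IsRegularElt (x.val : GL (Fin 3) (UnitaryGroup.LocalRing L v)) then ((𝔇.DG x : ℂ))⁻¹ * ∑ᶠ q : Quot (IsLocalStablyConjH L v), (if IsLocalGRegular L v q.out ∧ IsLocalNormPair L (qsForm L) v q.out x then finTau L v q.out μ * (𝔇.DH q.out : ℂ) * ((finKappaAt L v (qsForm L) q.out x : ℤ) : ℂ) * α q.out else 0) else 0) →  -- hUp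
          (∀ ρ ∈ 𝔇.sqPacketsH, ∀ C : Set ((UnitaryGroup.cmDatum L 2 (Matrix.of fun i j : Fin 2 => if i.val + j.val + 1 = 2 then (1 : L) else 0)).Local v × (UnitaryGroup.cmDatum L 1 (Matrix.of fun i j : Fin 1 => if i.val + j.val + 1 = 1 then (1 : L) else 0)).Local v), IsCompact C → ∃ B : ℝ, ∀ s ∈ C, IsLocalGRegular L v s → ‖(𝔇.DH s : ℂ) * 𝔇.packetCharH ρ s‖ ≤ B) →  -- hHBHP
          (∀ ξ' : ((UnitaryGroup.cmDatum L 2 (Matrix.of fun i j : Fin 2 => if i.val + j.val + 1 = 2 then (1 : L) else 0)).Local v × (UnitaryGroup.cmDatum L 1 (Matrix.of fun i j : Fin 1 => if i.val + j.val + 1 = 1 then (1 : L) else 0)).Local v) →* ℂˣ, Continuous ξ' → ∃ (η₁ η₂ : ↥(normOneUnits (conjLocal L (IsCMField.complexConj L) v)) →* ℂˣ), Continuous (fun x => ((η₁ x : ℂˣ) : ℂ)) ∧ Continuous (fun x => ((η₂ x : ℂˣ) : ℂ)) ∧ KeysCaseTwoLabels L v (μ.semilocalComponent L v) η₁ η₂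 (𝔇.pi2 ξ') (𝔇.piN ξ')) →  -- hlabels
          (∀ ψ' : ↥(Subgroup.center (Gqs L v)) →* ℂˣ, Continuous ψ' → ∃ ψ : ↥(normOneUnits (conjLocal L (IsCMField.complexConj L) v)) →* ℂˣ, Continuous ψ ∧ 𝔇.stG ψ' ≠ 𝔇.detG ψ' ∧ ∀ c : IrrClass (Gqs L v), c.IsConstituentOf (UnitaryGroup.cmPrincipalSeries L 3 v (UnitaryGroup.cmTorusCharPair L v (halfModulusChar (UnitaryGroup.LocalRing L v) * halfModulusChar (UnitaryGroup.LocalRing L v))⁻¹ ψ)) ↔ (c = 𝔇.stG ψ' ∨ c = 𝔇.detG ψ')) →  -- hSt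
          (∀ ψ₀ : ↥(normOneUnits (conjLocal L (IsCMField.complexConj L) v)) →* ℂˣ, Continuous (fun x => ((ψ₀ x : ℂˣ) : ℂ)) → ∃ ψ : ↥(Subgroup.center (Gqs L v)) →* ℂˣ, Continuous ψ ∧ ∀ c : IrrClass (Gqs L v), c.IsConstituentOf (UnitaryGroup.cmPrincipalSeries L 3 v (UnitaryGroup.cmTorusCharPair L v (halfModulusChar (UnitaryGroup.LocalRing L v) * halfModulusChar (UnitaryGroup.LocalRing L v))⁻¹ ψ₀)) ↔ (c = 𝔇.stG ψ ∨ c = 𝔇.detG ψ)) →  -- hStJH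
          (∀ (η₁ η₂ : ↥(normOneUnits (conjLocal L (IsCMField.complexConj L) v)) →* ℂˣ), Continuous (fun x => ((η₁ x : ℂˣ) : ℂ)) → Continuous (fun x => ((η₂ x : ℂˣ) : ℂ)) → ∃ ξ' : ((UnitaryGroup.cmDatum L 2 (Matrix.of fun i j : Fin 2 => if i.val + j.val + 1 = 2 then (1 : L) else 0)).Local v × (UnitaryGroup.cmDatum L 1 (Matrix.of fun i j : Fin 1 => if i.val + j.val + 1 = 1 then (1 : L) else 0)).Local v) →* ℂˣ, Continuous ξ' ∧ KeysCaseTwoLabels L v (μ.semilocalComponent L v) η₁ η₂ (𝔇.pi2 ξ') (𝔇.piN ξ')) →  -- hKeysJH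
          (∀ ρ ∈ 𝔇.sqPacketsH, ∀ a : ((UnitaryGroup.cmDatum L 2 (Matrix.of fun i j : Fin 2 => if i.val + j.val + 1 = 2 then (1 : L) else 0)).Local v × (UnitaryGroup.cmDatum L 1 (Matrix.of fun i j : Fin 1 => if i.val + j.val + 1 = 1 then (1 : L) else 0)).Local v), IsLocalGRegular L v a → ∀ᶠ a' in 𝓝 a, 𝔇.packetCharH ρ a' = 𝔇.packetCharH ρ a) →  -- hM1lc
          (∀ γ : Gqs L v, IsRegularElt (γ.val : GL (Fin 3) (UnitaryGroup.LocalRing L v)) → ∃ T' ∈ 𝔇.cartanAll, ∃ x : Gqs L v, ∀ g : Gqs L v, g ∈ Subgroup.centralizer ({γ} : Set (Gqs L v)) ↔ x⁻¹ * g * x ∈ T') →  -- hcovA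
          (∀ T' ∈ 𝔇.cartanAll, ∀ T'' ∈ 𝔇.cartanAll, T' ≠ T'' → ∀ y : Gqs L v, ¬ ∀ h : Gqs L v, h ∈ T'' ↔ y⁻¹ * h * y ∈ T') →  -- hncA
          (∀ T' ∈ 𝔇.cartanAll, T' ≠ (cmBorelTriple L 3 v).M → IsCompact (T' : Set (Gqs L v))) →  -- hcptA
          (∀ T' ∈ 𝔇.cartanAll, (𝔇.μT T').IsInvInvariant) →  -- hinvT
          (∀ T' ∈ 𝔇.cartanAll, 𝔇.μT T' (compactCore ↥T') = 1) →  -- hcoreT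
          (∀ π ∈ 𝔇.irredPS, ∃ (χ₁ : (UnitaryGroup.LocalRing L v)ˣ →* ℂˣ) (χ₂ : ↥(normOneUnits (conjLocal L (IsCMField.complexConj L) v)) →* ℂˣ), Continuous (fun x => ((χ₁ x : ℂˣ) : ℂ)) ∧ Continuous (fun x => ((χ₂ x : ℂˣ) : ℂ)) ∧ (UnitaryGroup.cmPrincipalSeries L 3 v (UnitaryGroup.cmTorusCharPair L v χ₁ χ₂)).IsIrreducible ∧ π.IsConstituentOf (UnitaryGroup.cmPrincipalSeries L 3 v (UnitaryGroup.cmTorusCharPair L v χ₁ χ₂))) →  -- hIrr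
          (∀ ξ' : ((UnitaryGroup.cmDatum L 2 (Matrix.of fun i j : Fin 2 => if i.val + j.val + 1 = 2 then (1 : L) else 0)).Local v × (UnitaryGroup.cmDatum L 1 (Matrix.of fun i j : Fin 1 => if i.val + j.val + 1 = 1 then (1 : L) else 0)).Local v) →* ℂˣ, (𝔇.pi2 ξ').IsSquareIntegrable 𝔇.μGZ ∧ ¬ (𝔇.piN ξ').IsSquareIntegrable 𝔇.μGZ) →  -- hKeys
          𝔇.DetNotL2 →  -- hDet
          𝔇.PacketCharHRegularity →  -- hM1H
          (∀ ψ' : ↥(Subgroup.center (Gqs L v)) →* ℂˣ, Continuous ψ' → 𝔇.IsL2 (𝔇.stG ψ')) →  -- hStL2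
          𝔇.cartanG = Sell →  -- eCartanG
          (∀ T' : Subgroup (Gqs L v), 𝔇.μT T' = μTf T') →  -- eMuT
          𝔇.cartanH = SH →  -- eCartanH
          (∀ T' : Subgroup ((UnitaryGroup.cmDatum L 2 (Matrix.of fun i j : Fin 2 => if i.val + j.val + 1 = 2 then (1 : L) else 0)).Local v × (UnitaryGroup.cmDatum L 1 (Matrix.of fun i j : Fin 1 => if i.val + j.val + 1 = 1 then (1 : L) else 0)).Local v), 𝔇.μTH T' = μTHf T') →  -- eMuTH
          (∀ a : ((UnitaryGroup.cmDatum L 2 (Matrix.of fun i j : Fin 2 => if i.val + j.val + 1 = 2 then (1 : L) else 0)).Local v × (UnitaryGroup.cmDatum L 1 (Matrix.of fun i j : Fin 1 => if i.val + j.val + 1 = 1 then (1 : L) else 0)).Local v), a ∈ 𝔇.regH ↔ IsLocalGRegular L v a) →  -- eRegH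
          (∀ a : ((UnitaryGroup.cmDatum L 2 (Matrix.of fun i j : Fin 2 => if i.val + j.val + 1 = 2 then (1 : L) else 0)).Local v × (UnitaryGroup.cmDatum L 1 (Matrix.of fun i j : Fin 1 => if i.val + j.val + 1 = 1 then (1 : L) else 0)).Local v), a ∈ 𝔇.ellH ↔ IsLocalGRegular L v a ∧ IsCompact ((Subgroup.centralizer ({a} : Set ((UnitaryGroup.cmDatum L 2 (Matrix.of fun i j : Fin 2 => if i.val + j.val + 1 = 2 then (1 : L) else 0)).Local v × (UnitaryGroup.cmDatum L 1 (Matrix.of fun i j : Fin 1 => if i.val + j.val + 1 = 1 then (1 : L) else 0)).Local v)) : Subgroup ((UnitaryGroup.cmDatum L 2 (Matrix.of fun i j : Fin 2 => if i.val + j.val + 1 = 2 then (1 : L) else 0)).Local v × (UnitaryGroup.cmDatum L 1 (Matrix.of fun i j : Fin 1 => if i.val + j.val + 1 = 1 then (1 : L) else 0)).Local v)) : Set ((UnitaryGroup.cmDatum L 2 (Matrix.of fun i j : Fin 2 => if i.val + j.val + 1 = 2 then (1 : L) else 0)).Local v × (UnitaryGroup.cmDatum L 1 (Matrix.of fun i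 j : Fin 1 => if i.val + j.val + 1 = 1 then (1 : L) else 0)).Local v))) →  -- eEllH
          𝔇.sqPacketsH = {({πSt} : Finset (IrrClass ((UnitaryGroup.cmDatum L 2 (Matrix.of fun i j : Fin 2 => if i.val + j.val + 1 = 2 then (1 : L) else 0)).Local v × (UnitaryGroup.cmDatum L 1 (Matrix.of fun i j : Fin 1 => if i.val + j.val + 1 = 1 then (1 : L) else 0)).Local v)))} →  -- eSq
          (∀ π : IrrClass (Gqs L v), (∃ (χ₁ : (UnitaryGroup.LocalRing L v)ˣ →* ℂˣ) (χ₂ : ↥(normOneUnits (conjLocal L (IsCMField.complexConj L) v)) →* ℂˣ), Continuous (fun x => ((χ₁ x : ℂˣ) : ℂ)) ∧ Continuous (fun x => ((χ₂ x : ℂˣ) : ℂ)) ∧ (UnitaryGroup.cmPrincipalSeries L 3 v (UnitaryGroup.cmTorusCharPair L v χ₁ χ₂)).IsIrreducible ∧ π.IsConstituentOf (UnitaryGroup.cmPrincipalSeries L 3 v (UnitaryGroup.cmTorusCharPair L v χ₁ χ₂))) → π ∈ 𝔇.irredPS) →  -- eIrr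
          (∀ (η₁ η₂ : ↥(normOneUnits (conjLocal L (IsCMField.complexConj L) v)) →* ℂˣ), Continuous (fun x => ((η₁ x : ℂˣ) : ℂ)) → Continuous (fun x => ((η₂ x : ℂˣ) : ℂ)) → ∀ ξ' : ((UnitaryGroup.cmDatum L 2 (Matrix.of fun i j : Fin 2 => if i.val + j.val + 1 = 2 then (1 : L) else 0)).Local v × (UnitaryGroup.cmDatum L 1 (Matrix.of fun i j : Fin 1 => if i.val + j.val + 1 = 1 then (1 : L) else 0)).Local v) →* ℂˣ, (∀ hh : ((UnitaryGroup.cmDatum L 2 (Matrix.of fun i j : Fin 2 => if i.val + j.val + 1 = 2 then (1 : L) else 0)).Local v × (UnitaryGroup.cmDatum L 1 (Matrix.of fun i j : Fin 1 => if i.val + j.val + 1 = 1 then (1 : L) else 0)).Local v), ξ' hh = η₁ (localDet (IsCMField.complexConj L) v (isUnit_antidiagOne_det L 2) hh.1) * η₂ (localDet (IsCMField.complexConj L) v (isUnit_antidiagOne_det L 2) hh.1 * localDet (IsCMField.complexConj L) v (isUnit_antidiagOne_det L 1) hh.2)) → KeysCaseTwoLabels L v (μ.semilocalComponent L v) η₁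 η₂ (𝔇.pi2 ξ') (𝔇.piN ξ')) →  -- eLab
          (∀ ρ : IrrClass ((UnitaryGroup.cmDatum L 2 (Matrix.of fun i j : Fin 2 => if i.val + j.val + 1 = 2 then (1 : L) else 0)).Local v × (UnitaryGroup.cmDatum L 1 (Matrix.of fun i j : Fin 1 => if i.val + j.val + 1 = 1 then (1 : L) else 0)).Local v), 𝔇.charH ρ = 𝔇.charH πSt) →  -- eCharH
          (∃ (ιZ : ↥(normOneUnits (conjLocal L (IsCMField.complexConj L) v)) →* ↥(Subgroup.center (Gqs L v))) (detZ : (Gqs L v) →* ↥(Subgroup.center (Gqs L v))), Continuous ιZ ∧ Continuous detZ ∧ (∀ z : ↥(normOneUnits (conjLocal L (IsCMField.complexConj L) v)), ((ιZ z).val.val.val : Matrix (Fin 3) (Fin 3) (UnitaryGroup.LocalRing L v)) = (((z : (UnitaryGroup.LocalRing L v)ˣ) : UnitaryGroup.LocalRing L v)) • (1 : Matrix (Fin 3) (Fin 3) (UnitaryGroup.LocalRing L v))) ∧ (∀ g : (Gqs L v), ((detZ g).val.val.val : Matrix (Fin 3) (Fin 3) (UnitaryGroup.LocalRing L v)) =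 (g.val.val : Matrix (Fin 3) (Fin 3) (UnitaryGroup.LocalRing L v)).det • (1 : Matrix (Fin 3) (Fin 3) (UnitaryGroup.LocalRing L v))) ∧ ∀ ψ : ↥(Subgroup.center (Gqs L v)) →* ℂˣ, Continuous ψ → (∃ hopen : IsOpen (((ψ.comp detZ).ker : Subgroup (Gqs L v)) : Set (Gqs L v)), 𝔇.detG ψ = IrrClass.mk (SmoothIrrep.ofChar (ψ.comp detZ) hopen)) ∧ 𝔇.stG ψ ≠ 𝔇.detG ψ ∧ (∀ c : IrrClass (Gqs L v), c.IsConstituentOf (cmPrincipalSeries L 3 v (cmTorusCharPair L v (halfModulusChar (UnitaryGroup.LocalRing L v) * halfModulusChar (UnitaryGroup.LocalRing L v))⁻¹ (ψ.comp ιZ))) ↔ (c = 𝔇.stG ψ ∨ c = 𝔇.detG ψ)) ∧ (𝔇.stG ψ).IsSquareIntegrable μZ ∧ ¬ (𝔇.detG ψ).IsSquareIntegrable μZ) →  -- eSt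
      ∀ π π' : IrrClass (Gqs L v), 𝔇.IsL2 π → 𝔇.IsL2 π' →
        𝔇.innerG (𝔇.char π) (𝔇.char π') = if π = π' then 1 else 0 := by
  intro L _ _ _ μ ξ v hns hμu hμω _ _ _ _ νHv νQv _ _ _ _ mHv mQv hcanH hcanQ hT_v π₁ πSt hlab hπ₁ _ _ μZ _
    Sell μTf SH μTHf c01 c02 c03 c04 c05 c06 c07 c08 c09 c10 c11 c12 𝔇 par
    p01 p02 p03 p04 p05 p06 p07 p08 p09 p10 p11 p12 p13 p14 p15 p16 p17 p18 p19 p20 p21 p22 p23 p24 p25 p26 p27 p28 p29 p30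
    p31 p32 p33 p34 p35 p36 p37 p38 p39 p40 p41 p42 p43 p44 p45 p46 p47 p48 p49 p50 p51 p52 p53 p54
  -- the socket's quotient σ-algebras are the INLINED `letI … := fun _ => borel _`; re-read them as local instances (★ J15's device)
  letI : ∀ γ : Gqs L v, MeasurableSpace (Gqs L v ⧸ Subgroup.centralizer ({γ} : Set (Gqs L v))) := fun _ => borel _
  haveI : ∀ γ : Gqs L v, BorelSpace (Gqs L v ⧸ Subgroup.centralizer ({γ} : Set (Gqs L v))) := fun _ => ⟨rfl⟩
  -- ★ PCT-OUT's five letters from the pins + `hHCB` (FILE B §0)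
  obtain ⟨hWIF, hC1, hC2, hC3, hL2⟩ := K2E3KazhdanL2OrthonormalNotWild.pctOutLetters_of_pins L v hns νQv mQv hcanQ 𝔇
    p01 p04 p05 p08 p09 p10 p11 p12 p13 p14 p15 p16 p34 p35 p36 p37 p38 hHCB
  by_cases hv : Algebra.IsUnramifiedIn (𝓞 L) v.asIdeal ∨ Valued.v (2 : v.adicCompletion ↥(maximalRealSubfield L)) = 1
  · -- NOT WILD: FILE B §1 (★ 73 + ★ (S5) on the diagonal; ★ (X0′-NW) + ★ HOM-ZERO + FILE A off the diagonal)
    exact K2E3KazhdanL2OrthonormalNotWild.innerG_char_eq_ite_of_isL2_of_not_wild L v hns hv νQv mQv hcanQ 𝔇 p01 p04 p05 p08 p09 μZ p03 hWIF hC1 hC2 hC3 hL2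
  · -- WILD: the residual
    exact hwild L v hns hv νQv mQv hcanQ 𝔇 p01 p04 p05 p08 p09 μZ p03 hWIF hC1 hC2 hC3 hL2


/-! ## §2 THE WILD RESIDUAL ⟸ the two EP heads the tree lacks at wild places (the wild twins of ★ 73 §NW and ★ (X0′-NW), junction letters) -/

set_option maxHeartbeats 1600000 in
set_option synthInstance.maxHeartbeats 400000 in
open Filter Topology Pointwise Summit.HodgeConjecture.HodgeConjecture.Cruxes.H413.F0P3cStCharTSTorusDefs in
open scoped Classical in
/-- **THE WILD RESIDUAL `hwild` OF `sig_K2E3KazhdanL2Orthonormal_of_charLocBdd_of_wild` FROM TWO SOCKET-SHAPED EP HEADS AT THE WILD PLACES** — the exact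
debt of row #15 after this seat: `h73w` = the WILD twin of ★ 73 §NW `innerG_char_self_eq_one_of_hsplit_of_not_wild` (`⟨χ_⟦r⟧, χ_⟦r⟧⟩_e = 1` for every irreducible
smooth `r` whose smooth self-extensions split) and `hX0w` = the WILD twin of ★ (X0′-NW) `innerG_char_cross_eq_zero_of_not_wild` (`⟨χ_⟦r′⟧, χ_⟦r⟧⟩_e = 0` from
`hsplit₂` + `Hom_G(r, r′) = 0`), both with the place token `¬ (v unramified in L ∨ |2|_v = 1)` and otherwise the letters of their not-wild originals VERBATIM
(what the Schneider–Stuhler ∕ Kottwitz resolution on the WILD `U(3)` tree — ★ row #21 `K2E3EPFunctionGWild` and the ★ `…Wild` lattice-tree leaves of Track A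
«FOUR-FRAME» — has to deliver: the wild twins of E1 rows 41–61b, 72–73, 80).  Given them, `hwild` is FILE B §1's proof verbatim: ★ (S5)
`hsplit_of_isSquareIntegrable` feeds `h73w` on the diagonal, FILE A `crossExtension_splits_of_isSquareIntegrable` + ★ HOM-ZERO feed `hX0w` off it.
[cite: Rogawski1990, Prop. 12.6.1 (a) p. 188] [cite: Kazhdan1986CuspidalGeometry, Thm. K] [cite: SchneiderStuhler1997, §III.4] [cite: Kottwitz1988, §2] -/
theorem kazhdanWildResidual_of_epWildHeads
    (h73w : ∀ (L : Type) [Field L] [NumberField L] [IsCMField L] (v : Pl L),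
      (∀ w : PlacesOver L v, IsCMField.complexConj L • w.1 = w.1) →
      ¬ (Algebra.IsUnramifiedIn (𝓞 L) v.asIdeal ∨ Valued.v (2 : v.adicCompletion ↥(maximalRealSubfield L)) = 1) →
      ∀ [MeasurableSpace (Gqs L v)] [BorelSpace (Gqs L v)]
        [∀ γ : Gqs L v, MeasurableSpace (Gqs L v ⧸ Subgroup.centralizer ({γ} : Set (Gqs L v)))]
        [∀ γ : Gqs L v, BorelSpace (Gqs L v ⧸ Subgroup.centralizer ({γ} : Set (Gqs L v)))]
        [MeasurableSpace (Gqs L v ⧸ Subgroup.center (Gqs L v))]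
        {H : Type} [Group H] [TopologicalSpace H] [IsTopologicalGroup H] [MeasurableSpace H]
        (νQv : Measure (Gqs L v)) [νQv.IsHaarMeasure] [νQv.IsMulRightInvariant] (mQv : OrbitalMeasureFamily (Gqs L v)),
        mQv.IsCanonical (fun γ => IsRegularElt (γ.val : GL (Fin 3) (UnitaryGroup.LocalRing L v))) νQv →
      ∀ (𝔇 : Ch12Sec5.EllipticData (Gqs L v) H), 𝔇.μG = νQv → 𝔇.orb = mQv →
        (∀ γ : Gqs L v, γ ∈ 𝔇.regG ↔ IsRegularElt (γ.val : GL (Fin 3) (UnitaryGroup.LocalRing L v))) →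
        (∀ γ : Gqs L v, γ ∈ 𝔇.ellG ↔ IsRegularElt (γ.val : GL (Fin 3) (UnitaryGroup.LocalRing L v)) ∧ γ ∉ hyperbolicSet L v) →
        (∀ π : IrrClass (Gqs L v), Measurable (𝔇.char π) ∧ LocallyIntegrable (𝔇.char π) 𝔇.μG ∧ (∀ x ∈ 𝔇.regG, ∀ᶠ y in 𝓝 x, 𝔇.char π y = 𝔇.char π x) ∧
          ∀ φ : Gqs L v → ℂ, IsLocSmooth φ → π.smoothTrace 𝔇.μG φ = ∫ x, φ x * 𝔇.char π x ∂𝔇.μG) →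
        𝔇.WeylIntegrationFormula → 𝔇.EllCartanSubset → 𝔇.EllCartanAE → 𝔇.NonEllCartanAE → 𝔇.L2CharOnTorusAll →
      ∀ (r : SmoothIrrep (Gqs L v)),
        (∀ (E : Type) [AddCommGroup E] [Module ℂ E] (ρE : Representation ℂ (Gqs L v) E), ρE.IsSmooth →
          ∀ (i : r.ρ.IntertwiningMap ρE) (p : ρE.IntertwiningMap r.ρ), Function.Injective i → LinearMap.ker p.toLinearMap = LinearMap.range i.toLinearMap →
            Function.Surjective p → ∃ s : r.ρ.IntertwiningMap ρE, p.comp s = Representation.IntertwiningMap.id r.ρ) →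
        𝔇.innerG (𝔇.char (IrrClass.mk r)) (𝔇.char (IrrClass.mk r)) = 1)
    (hX0w : ∀ (L : Type) [Field L] [NumberField L] [IsCMField L] (v : Pl L),
      (∀ w : PlacesOver L v, IsCMField.complexConj L • w.1 = w.1) →
      ¬ (Algebra.IsUnramifiedIn (𝓞 L) v.asIdeal ∨ Valued.v (2 : v.adicCompletion ↥(maximalRealSubfield L)) = 1) →
      ∀ [MeasurableSpace (Gqs L v)] [BorelSpace (Gqs L v)]
        [∀ γ : Gqs L v, MeasurableSpace (Gqs L v ⧸ Subgroup.centralizer ({γ} : Set (Gqs L v)))]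
        [∀ γ : Gqs L v, BorelSpace (Gqs L v ⧸ Subgroup.centralizer ({γ} : Set (Gqs L v)))]
        [MeasurableSpace (Gqs L v ⧸ Subgroup.center (Gqs L v))]
        {H : Type} [Group H] [TopologicalSpace H] [IsTopologicalGroup H] [MeasurableSpace H]
        (νQv : Measure (Gqs L v)) [νQv.IsHaarMeasure] [νQv.IsMulRightInvariant] (mQv : OrbitalMeasureFamily (Gqs L v)),
        mQv.IsCanonical (fun γ => IsRegularElt (γ.val : GL (Fin 3) (UnitaryGroup.LocalRing L v))) νQv →
      ∀ (𝔇 : Ch12Sec5.EllipticData (Gqs L v) H), 𝔇.μG = νQv → 𝔇.orb = mQv →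
        (∀ γ : Gqs L v, γ ∈ 𝔇.regG ↔ IsRegularElt (γ.val : GL (Fin 3) (UnitaryGroup.LocalRing L v))) →
        (∀ γ : Gqs L v, γ ∈ 𝔇.ellG ↔ IsRegularElt (γ.val : GL (Fin 3) (UnitaryGroup.LocalRing L v)) ∧ γ ∉ hyperbolicSet L v) →
        (∀ π : IrrClass (Gqs L v), Measurable (𝔇.char π) ∧ LocallyIntegrable (𝔇.char π) 𝔇.μG ∧ (∀ x ∈ 𝔇.regG, ∀ᶠ y in 𝓝 x, 𝔇.char π y = 𝔇.char π x) ∧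
          ∀ φ : Gqs L v → ℂ, IsLocSmooth φ → π.smoothTrace 𝔇.μG φ = ∫ x, φ x * 𝔇.char π x ∂𝔇.μG) →
        𝔇.WeylIntegrationFormula → 𝔇.EllCartanSubset → 𝔇.EllCartanAE → 𝔇.NonEllCartanAE → 𝔇.L2CharOnTorusAll →
      ∀ (r r' : SmoothIrrep (Gqs L v)),
        (∀ (E : Type) [AddCommGroup E] [Module ℂ E] (ρE : Representation ℂ (Gqs L v) E), ρE.IsSmooth →
          ∀ (i : r'.ρ.IntertwiningMap ρE) (p : ρE.IntertwiningMap r.ρ), Function.Injective i → LinearMap.ker p.toLinearMap = LinearMap.range i.toLinearMap →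
            Function.Surjective p → ∃ s : r.ρ.IntertwiningMap ρE, p.comp s = Representation.IntertwiningMap.id r.ρ) →
        Subsingleton (r.ρ.IntertwiningMap r'.ρ) →
        𝔇.innerG (𝔇.char (IrrClass.mk r')) (𝔇.char (IrrClass.mk r)) = 0) :
    ∀ (L : Type) [Field L] [NumberField L] [IsCMField L] (v : Pl L),
      (∀ w : PlacesOver L v, IsCMField.complexConj L • w.1 = w.1) →
      ¬ (Algebra.IsUnramifiedIn (𝓞 L) v.asIdeal ∨ Valued.v (2 : v.adicCompletion ↥(maximalRealSubfield L)) = 1) →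
      ∀ [MeasurableSpace (Gqs L v)] [BorelSpace (Gqs L v)]
        [∀ γ : Gqs L v, MeasurableSpace (Gqs L v ⧸ Subgroup.centralizer ({γ} : Set (Gqs L v)))]
        [∀ γ : Gqs L v, BorelSpace (Gqs L v ⧸ Subgroup.centralizer ({γ} : Set (Gqs L v)))]
        [MeasurableSpace (Gqs L v ⧸ Subgroup.center (Gqs L v))] [BorelSpace (Gqs L v ⧸ Subgroup.center (Gqs L v))]
        {H : Type} [Group H] [TopologicalSpace H] [IsTopologicalGroup H] [MeasurableSpace H]
        (νQv : Measure (Gqs L v)) [νQv.IsHaarMeasure] [νQv.IsMulRightInvariant] (mQv : OrbitalMeasureFamily (Gqs L v)),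
        mQv.IsCanonical (fun γ => IsRegularElt (γ.val : GL (Fin 3) (UnitaryGroup.LocalRing L v))) νQv →
      ∀ (𝔇 : Ch12Sec5.EllipticData (Gqs L v) H), 𝔇.μG = νQv → 𝔇.orb = mQv →
        (∀ γ : Gqs L v, γ ∈ 𝔇.regG ↔ IsRegularElt (γ.val : GL (Fin 3) (UnitaryGroup.LocalRing L v))) →
        (∀ γ : Gqs L v, γ ∈ 𝔇.ellG ↔ IsRegularElt (γ.val : GL (Fin 3) (UnitaryGroup.LocalRing L v)) ∧ γ ∉ hyperbolicSet L v) →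
        (∀ π : IrrClass (Gqs L v), Measurable (𝔇.char π) ∧ LocallyIntegrable (𝔇.char π) 𝔇.μG ∧ (∀ x ∈ 𝔇.regG, ∀ᶠ y in 𝓝 x, 𝔇.char π y = 𝔇.char π x) ∧
          ∀ φ : Gqs L v → ℂ, IsLocSmooth φ → π.smoothTrace 𝔇.μG φ = ∫ x, φ x * 𝔇.char π x ∂𝔇.μG) →
      ∀ (μZ : Measure (Gqs L v ⧸ Subgroup.center (Gqs L v))) [μZ.IsHaarMeasure], 𝔇.μGZ = μZ →
        𝔇.WeylIntegrationFormula → 𝔇.EllCartanSubset → 𝔇.EllCartanAE → 𝔇.NonEllCartanAE → 𝔇.L2CharOnTorusAll →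
      ∀ π π' : IrrClass (Gqs L v), 𝔇.IsL2 π → 𝔇.IsL2 π' → 𝔇.innerG (𝔇.char π) (𝔇.char π') = if π = π' then 1 else 0 := by
  intro L _ _ _ v hns hv _ _ _ _ _ _ H _ _ _ _ νQv _ _ mQv hcanQ 𝔇 hμG horb hreg hE hM1 μZ _ hμGZ hWIF hC1 hC2 hC3 hL2 π π' hπ hπ'
  obtain ⟨r, rfl⟩ := IrrClass.mk_surjective π
  obtain ⟨r', rfl⟩ := IrrClass.mk_surjective π'
  have hL2r : (IrrClass.mk r).IsSquareIntegrable μZ := by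
    have h : IrrClass.IsSquareIntegrable 𝔇.μGZ (IrrClass.mk r) := hπ
    rwa [hμGZ] at h
  have hL2r' : (IrrClass.mk r').IsSquareIntegrable μZ := by
    have h : IrrClass.IsSquareIntegrable 𝔇.μGZ (IrrClass.mk r') := hπ'
    rwa [hμGZ] at h
  by_cases hrr : IrrClass.mk r = IrrClass.mk r'
  · rw [if_pos hrr, ← hrr]
    exact h73w L v hns hv νQv mQv hcanQ 𝔇 hμG horb hreg hE hM1 hWIF hC1 hC2 hC3 hL2 r
      (F0P3cStCharTSHsplitOfL2.hsplit_of_isSquareIntegrable L v hns μZ r hL2r)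
  · rw [if_neg hrr]
    exact hX0w L v hns hv νQv mQv hcanQ 𝔇 hμG horb hreg hE hM1 hWIF hC1 hC2 hC3 hL2 r' r
      (K2E3KazhdanL2OrthonormalCrossExtSplit.crossExtension_splits_of_isSquareIntegrable L v hns μZ r' r hL2r' hL2r)
      (SmoothIrrep.subsingleton_intertwiningMap_of_mk_ne_mk r' r (Ne.symm hrr))

end Summit.HodgeConjecture.HodgeConjecture.Cruxes.H413.K2E3KazhdanL2Orthonormal

end
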